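import Mathlib
import Literature.NumberTheory.Transcendental.ExpVarietiesDimension
import Literature.ModelTheory.Zilber.EACProofs
import HarnessLib

/-!
# The Fermat surfaces `{x₀ᴺ + x₁ᴺ = 1, y₀ + y₁ = 1}` are irreducible surfaces

Zilber's Exponential-Algebraic Closedness, case ladder (host summit Schanuel, cell `pub-schanuel`,
seat 2, gen 5).  ALGEBRAIC half of our treatment of Mantova–Masser's example (fermat)
[MantovaMasser2023, §1 Further remarks, p. 5]: for every `N ≥ 1` the set
`S_N = {x₀ᴺ + x₁ᴺ = 1, y₀ + y₁ = 1} ⊆ ℂ² × ℂ²` is an irreducible Zariski closed set of dimension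
`≤ 2` (`isIrreducibleClosed_fermatSurface`, `zariskiDim_fermatSurface_le`) — the two structural
hypotheses of THEOREM G (`unprojectedDense_of_growth`).

* `irreducible_fermatPoly`: `x₀ᴺ + x₁ᴺ - 1` is irreducible in `ℂ[x₀, x₁, y₀, y₁]` — Eisenstein's
  criterion for `Tᴺ + (x₁ᴺ - 1) ∈ ℂ[x₁, y₀, y₁][T]` at the prime `ker(x₁ ↦ 1)` (it contains `x₁ᴺ - 1`,
  and `x₁ᴺ - 1 ∉ ker²` because the derivation `∂/∂x₁` followed by `x₁ ↦ 1` kills `ker²` but sends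
  `x₁ᴺ - 1` to `N ≠ 0`), transported along `ℂ[x₁,y₀,y₁][T] ≃ ℂ[Option (Fin 3)] ≃ ℂ[Fin 2 ⊕ Fin 2]`.
* `vanishingIdeal_fermatSurface`: `I(S_N)` is the preimage of the prime `(x₀ᴺ + x₁ᴺ - 1)` under the
  substitution `y₁ ↦ 1 - y₀` (`S_N` is the image of the cylinder `{x₀ᴺ + x₁ᴺ = 1}` under
  `y₁ ↦ 1 - y₀`), hence prime.
* `zariskiDim_fermatSurface_le`: the coordinate ring is integral over `ℂ[x̄₀, ȳ₀]`
  (`x̄₁ᴺ = 1 - x̄₀ᴺ`, `ȳ₁ = 1 - ȳ₀`), so `trdeg ≤ 2` (`trdeg_le_cardinalMk`).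

HONEST FRAMING: routine commutative algebra; `EC(3,2)` OPEN; nothing here bears on Schanuel's
conjecture.
-/

noncomputable section

open MvPolynomial
open Literature.NumberTheory.Transcendental Literature.ModelTheory.Zilber

set_option linter.dupNamespace false

namespace Summit.Schanuel.Schanuel.Theorems

/-! ## Eisenstein: `Tᴺ + (x₁ᴺ - 1)` is irreducible over `ℂ[x₁, y₀, y₁]` -/

/-- The substitution `x₁ ↦ 1` kills `∂q/∂x₁` for every `q` in the square of its kernel. [folklore] -/
theorem aeval_pderiv_eq_zero_of_mem_sq {n : ℕ} (i : Fin n) (q : MvPolynomial (Fin n) ℂ)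
    (hq : q ∈ (RingHom.ker (aeval (R := ℂ) (Function.update (X : Fin n → MvPolynomial (Fin n) ℂ) i 1)
      : MvPolynomial (Fin n) ℂ →ₐ[ℂ] MvPolynomial (Fin n) ℂ)) ^ 2) :
    aeval (Function.update (X : Fin n → MvPolynomial (Fin n) ℂ) i 1) (pderiv i q) = 0 := by
  rw [pow_two] at hq
  refine Submodule.mul_induction_on hq (fun a ha b hb => ?_) (fun a b ha hb => ?_)
  · rw [RingHom.mem_ker] at ha hb
    rw [pderiv_mul, map_add, map_mul, map_mul]
    -- careful: `aeval` is applied as an `AlgHom`; the kernel statements are about the same map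
    have ha' : aeval (Function.update (X : Fin n → MvPolynomial (Fin n) ℂ) i 1) a = 0 := ha
    have hb' : aeval (Function.update (X : Fin n → MvPolynomial (Fin n) ℂ) i 1) b = 0 := hb
    rw [ha', hb', mul_zero, zero_mul, add_zero]
  · rw [map_add, map_add, ha, hb, add_zero]

/-- **`Tᴺ + (x₀ᴺ - 1)` is irreducible in `ℂ[x₀, …, x_{n-1}][T]`** (`N ≥ 1`; Eisenstein at
`ker(x₀ ↦ 1)`). [folklore] -/
theorem irreducible_X_pow_add_C_X_pow_sub_one {n : ℕ} (i : Fin n) {N : ℕ} (hN : 1 ≤ N) :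
    Irreducible (Polynomial.X ^ N + Polynomial.C ((X i : MvPolynomial (Fin n) ℂ) ^ N - 1)) := by
  set A := MvPolynomial (Fin n) ℂ
  set v : Fin n → A := Function.update (X : Fin n → A) i 1 with hv
  set φ : A →ₐ[ℂ] A := aeval v with hφ
  set P : Ideal A := RingHom.ker φ with hP
  haveI hPprime : P.IsPrime := RingHom.ker_isPrime _
  have hvi : v i = 1 := by rw [hv, Function.update_self]
  have hc : φ ((X i : A) ^ N - 1) = 0 := by
    rw [map_sub, map_pow, hφ, aeval_X, hvi, one_pow, map_one, sub_self]
  have hNpos : 0 < N := hN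
  refine Polynomial.irreducible_of_eisenstein_criterion hPprime ?_ ?_ ?_ ?_ ?_
  · -- leading coefficient `1 ∉ P`
    rw [Polynomial.leadingCoeff_X_pow_add_C hNpos]
    exact fun h => hPprime.ne_top ((Ideal.eq_top_iff_one _).2 h)
  · -- lower coefficients lie in `P`
    intro m hm
    rw [Polynomial.degree_X_pow_add_C hNpos] at hm
    have hm' : m < N := by exact_mod_cast hm
    rw [Polynomial.coeff_add, Polynomial.coeff_X_pow, if_neg hm'.ne, zero_add, Polynomial.coeff_C]
    split_ifs with h0
    · exact hc
    · exact P.zero_mem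
  · rw [Polynomial.degree_X_pow_add_C hNpos]; exact_mod_cast hNpos
  · -- constant coefficient `x_i^N - 1 ∉ P²`: apply `∂/∂x_i` then `x_i ↦ 1`
    rw [Polynomial.coeff_add, Polynomial.coeff_X_pow, if_neg hNpos.ne, zero_add, Polynomial.coeff_C,
      if_pos rfl]
    intro hmem
    have h0 := aeval_pderiv_eq_zero_of_mem_sq i _ hmem
    rw [map_sub, (pderiv i).leibniz_pow, pderiv_X_self, pderiv_one, sub_zero, smul_eq_mul, mul_one,
      map_nsmul, map_pow, aeval_X, Function.update_self, one_pow, nsmul_eq_mul, mul_one,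
      Nat.cast_eq_zero] at h0
    omega
  · exact (Polynomial.monic_X_pow_add_C _ hNpos.ne').isPrimitive

/-- **`x₀ᴺ + x₁ᴺ - 1` is irreducible in `ℂ[x₀, x₁, y₀, y₁]`** (`N ≥ 1`). [folklore] -/
theorem irreducible_fermatPoly {N : ℕ} (hN : 1 ≤ N) :
    Irreducible ((X (Sum.inl 0) : MvPolynomial (Fin 2 ⊕ Fin 2) ℂ) ^ N + X (Sum.inl 1) ^ N - 1) := by
  -- `Option (Fin 3) ≃ Fin 2 ⊕ Fin 2`, `none ↦ inl 0`, `some 0 ↦ inl 1`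
  set e : Option (Fin 3) ≃ Fin 2 ⊕ Fin 2 :=
    (finSuccEquiv 3).symm.trans (finSumFinEquiv (m := 2) (n := 2)).symm with he
  have he0 : e none = Sum.inl 0 := by rw [he]; decide
  have he1 : e (some 0) = Sum.inl 1 := by rw [he]; decide
  have h1 := irreducible_X_pow_add_C_X_pow_sub_one (0 : Fin 3) hN
  -- transport along `optionEquivLeft.symm` and `rename e`
  set E₁ := (optionEquivLeft ℂ (Fin 3)).symm
  set E₂ := renameEquiv ℂ e
  have h2 : E₂ (E₁ (Polynomial.X ^ N + Polynomial.C ((X 0 : MvPolynomial (Fin 3) ℂ) ^ N - 1))) =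
      (X (Sum.inl 0) : MvPolynomial (Fin 2 ⊕ Fin 2) ℂ) ^ N + X (Sum.inl 1) ^ N - 1 := by
    simp only [E₁, E₂, map_add, map_sub, map_pow, map_one, optionEquivLeft_symm_X,
      optionEquivLeft_symm_C_X, renameEquiv_apply, rename_X, he0, he1]
    ring
  rw [← h2, MulEquiv.irreducible_iff, MulEquiv.irreducible_iff]
  exact h1

/-! ## The vanishing ideal of the Fermat surface -/

section Surface

variable (N : ℕ)

/-- The cylinder `{x₀ᴺ + x₁ᴺ = 1} ⊆ ℂ² × ℂ²` is `Z(x₀ᴺ + x₁ᴺ - 1)`. [folklore] -/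
theorem zeroLocus_span_fermatPoly :
    zeroLocus ℂ (Ideal.span {((X (Sum.inl 0) : MvPolynomial (Fin 2 ⊕ Fin 2) ℂ) ^ N +
      X (Sum.inl 1) ^ N - 1)}) =
      {s : Fin 2 ⊕ Fin 2 → ℂ | s (Sum.inl 0) ^ N + s (Sum.inl 1) ^ N = 1} := by
  rw [zeroLocus_span]
  ext s
  simp only [Set.mem_singleton_iff, forall_eq, Set.mem_setOf_eq, map_sub, map_add, map_pow, aeval_X,
    map_one, sub_eq_zero]

/-- The Fermat surface is `Z(x₀ᴺ + x₁ᴺ - 1, y₀ + y₁ - 1)`; in particular it is Zariski closed.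
[folklore] -/
theorem fermatSurface_eq_zeroLocus :
    {s : Fin 2 ⊕ Fin 2 → ℂ | s (Sum.inl 0) ^ N + s (Sum.inl 1) ^ N = 1 ∧ s (Sum.inr 0) + s (Sum.inr 1) = 1} =
      zeroLocus ℂ (Ideal.span {((X (Sum.inl 0) : MvPolynomial (Fin 2 ⊕ Fin 2) ℂ) ^ N +
        X (Sum.inl 1) ^ N - 1), X (Sum.inr 0) + X (Sum.inr 1) - 1}) := by
  rw [zeroLocus_span]
  ext s
  simp only [Set.mem_setOf_eq, Set.mem_insert_iff, Set.mem_singleton_iff, forall_eq_or_imp, forall_eq,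
    map_sub, map_add, map_pow, aeval_X, map_one, sub_eq_zero]

/-- **The vanishing ideal of the Fermat surface** is the preimage of the prime `(x₀ᴺ + x₁ᴺ - 1)`
under the substitution `y₁ ↦ 1 - y₀`. [folklore] -/
theorem vanishingIdeal_fermatSurface (hN : 1 ≤ N) :
    vanishingIdeal ℂ {s : Fin 2 ⊕ Fin 2 → ℂ | s (Sum.inl 0) ^ N + s (Sum.inl 1) ^ N = 1 ∧
        s (Sum.inr 0) + s (Sum.inr 1) = 1} =
      (Ideal.span {((X (Sum.inl 0) : MvPolynomial (Fin 2 ⊕ Fin 2) ℂ) ^ N + X (Sum.inl 1) ^ N - 1)}).comap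
        (bind₁ (Function.update (X : Fin 2 ⊕ Fin 2 → MvPolynomial (Fin 2 ⊕ Fin 2) ℂ) (Sum.inr 1)
          (1 - X (Sum.inr 0)))) := by
  classical
  set f : MvPolynomial (Fin 2 ⊕ Fin 2) ℂ := X (Sum.inl 0) ^ N + X (Sum.inl 1) ^ N - 1 with hf
  set u : Fin 2 ⊕ Fin 2 → MvPolynomial (Fin 2 ⊕ Fin 2) ℂ :=
    Function.update (X : Fin 2 ⊕ Fin 2 → MvPolynomial (Fin 2 ⊕ Fin 2) ℂ) (Sum.inr 1) (1 - X (Sum.inr 0))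
    with hu
  -- the point map `φ s = (x₀, x₁, y₀, 1 - y₀)` and `aeval (φ s) p = aeval s (bind₁ u p)`
  have hφ : ∀ (s : Fin 2 ⊕ Fin 2 → ℂ) (p : MvPolynomial (Fin 2 ⊕ Fin 2) ℂ),
      aeval (fun v => aeval s (u v)) p = aeval s (bind₁ u p) := fun s p => (aeval_bind₁ s u p).symm
  have hφpt : ∀ t : Fin 2 ⊕ Fin 2 → ℂ,
      (fun v => aeval t (u v)) = Function.update t (Sum.inr 1) (1 - t (Sum.inr 0)) := by
    intro t; funext v
    by_cases hv : v = Sum.inr 1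
    · subst hv; simp only [hu, Function.update_self, map_sub, map_one, aeval_X]
    · simp only [hu, Function.update_of_ne hv, aeval_X]
  have hne0 : (Sum.inl 0 : Fin 2 ⊕ Fin 2) ≠ Sum.inr 1 := by decide
  have hne1 : (Sum.inl 1 : Fin 2 ⊕ Fin 2) ≠ Sum.inr 1 := by decide
  have hne2 : (Sum.inr 0 : Fin 2 ⊕ Fin 2) ≠ Sum.inr 1 := by decide
  -- `I(Z(f)) = (f)`
  haveI hprime : (Ideal.span {f}).IsPrime :=
    (Ideal.span_singleton_prime (irreducible_fermatPoly hN).ne_zero).2 (irreducible_fermatPoly hN).prime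
  have hIT : vanishingIdeal ℂ (zeroLocus ℂ (Ideal.span {f})) = Ideal.span {f} :=
    MvPolynomial.IsPrime.vanishingIdeal_zeroLocus _
  rw [← hIT]
  ext p
  rw [Ideal.mem_comap, mem_vanishingIdeal_iff, mem_vanishingIdeal_iff, zeroLocus_span_fermatPoly]
  constructor
  · -- `p` vanishes on `S` ⇒ `bind₁ u p` vanishes on the cylinder
    intro hp t ht
    rw [← hφ, hφpt]
    apply hp
    simp only [Set.mem_setOf_eq, Function.update_self, Function.update_of_ne hne0,
      Function.update_of_ne hne1, Function.update_of_ne hne2]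
    exact ⟨ht, by ring⟩
  · -- `bind₁ u p` vanishes on the cylinder ⇒ `p` vanishes on `S` (`s = φ s` there)
    intro hp s hs
    have hfix : Function.update s (Sum.inr 1) (1 - s (Sum.inr 0)) = s := by
      funext v
      by_cases hv : v = Sum.inr 1
      · subst hv; rw [Function.update_self]; linear_combination -hs.2
      · rw [Function.update_of_ne hv]
    have := hp s hs.1
    rwa [← hφ, hφpt, hfix] at this

/-- **The Fermat surface is an irreducible Zariski closed set** (`N ≥ 1`). [folklore] -/
theorem isIrreducibleClosed_fermatSurface (hN : 1 ≤ N) :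
    IsIrreducibleClosed ℂ {s : Fin 2 ⊕ Fin 2 → ℂ | s (Sum.inl 0) ^ N + s (Sum.inl 1) ^ N = 1 ∧
      s (Sum.inr 0) + s (Sum.inr 1) = 1} := by
  refine ⟨⟨_, fermatSurface_eq_zeroLocus N⟩, ?_⟩
  rw [vanishingIdeal_fermatSurface N hN]
  haveI : (Ideal.span {((X (Sum.inl 0) : MvPolynomial (Fin 2 ⊕ Fin 2) ℂ) ^ N +
      X (Sum.inl 1) ^ N - 1)}).IsPrime :=
    (Ideal.span_singleton_prime (irreducible_fermatPoly hN).ne_zero).2 (irreducible_fermatPoly hN).prime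
  exact Ideal.comap_isPrime _ _

/-! ## Dimension `≤ 2` -/

/-- **`dim S_N ≤ 2`**: the coordinate ring `ℂ[S_N]` is integral over `ℂ[x̄₀, ȳ₀]`. [folklore] -/
theorem zariskiDim_fermatSurface_le (hN : 1 ≤ N) :
    zariskiDim ℂ {s : Fin 2 ⊕ Fin 2 → ℂ | s (Sum.inl 0) ^ N + s (Sum.inl 1) ^ N = 1 ∧
      s (Sum.inr 0) + s (Sum.inr 1) = 1} ≤ (2 : ℕ) := by
  classical
  set S := {s : Fin 2 ⊕ Fin 2 → ℂ | s (Sum.inl 0) ^ N + s (Sum.inl 1) ^ N = 1 ∧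
      s (Sum.inr 0) + s (Sum.inr 1) = 1} with hSdef
  have hS := isIrreducibleClosed_fermatSurface N hN
  set I := vanishingIdeal ℂ S with hI
  haveI : I.IsPrime := hS.2
  have hSZ : S = zeroLocus ℂ I := eq_zeroLocus_vanishingIdeal_of_isZariskiClosed hS.1
  rw [hSZ, zariskiDim_zeroLocus_eq_trdeg I]
  -- the coordinate ring and its generators
  set Q := MvPolynomial (Fin 2 ⊕ Fin 2) ℂ ⧸ I
  haveI : IsDomain Q := Ideal.Quotient.isDomain I
  set x : Fin 2 ⊕ Fin 2 → Q := fun v => Ideal.Quotient.mk I (X v) with hx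
  -- the relations in `Q`
  have hmem : ∀ p : MvPolynomial (Fin 2 ⊕ Fin 2) ℂ, (∀ s ∈ S, aeval s p = 0) → Ideal.Quotient.mk I p = 0 :=
    fun p hp => Ideal.Quotient.eq_zero_iff_mem.2 ((mem_vanishingIdeal_iff).2 hp)
  have hrel1 : x (Sum.inl 1) ^ N = 1 - x (Sum.inl 0) ^ N := by
    have h := hmem (X (Sum.inl 0) ^ N + X (Sum.inl 1) ^ N - 1) fun s hs => by
      simp only [map_sub, map_add, map_pow, aeval_X, map_one, sub_eq_zero]; exact hs.1
    simp only [map_sub, map_add, map_pow, map_one] at h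
    rw [hx]; linear_combination h
  have hrel2 : x (Sum.inr 1) = 1 - x (Sum.inr 0) := by
    have h := hmem (X (Sum.inr 0) + X (Sum.inr 1) - 1) fun s hs => by
      simp only [map_sub, map_add, aeval_X, map_one, sub_eq_zero]; exact hs.2
    simp only [map_sub, map_add, map_one] at h
    rw [hx]; linear_combination h
  -- `K₀ = ℂ[x̄₀, ȳ₀]`
  set s₀ : Set Q := {x (Sum.inl 0), x (Sum.inr 0)} with hs₀
  set K₀ := Algebra.adjoin ℂ s₀ with hK₀
  have hx0 : x (Sum.inl 0) ∈ K₀ := Algebra.subset_adjoin (by simp [hs₀])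
  have hy0 : x (Sum.inr 0) ∈ K₀ := Algebra.subset_adjoin (by simp [hs₀])
  -- every generator is integral over `K₀`
  have h00 : IsIntegral K₀ (x (Sum.inl 0)) :=
    isIntegral_algebraMap (A := Q) (x := (⟨x (Sum.inl 0), hx0⟩ : K₀))
  have h10 : IsIntegral K₀ (x (Sum.inr 0)) :=
    isIntegral_algebraMap (A := Q) (x := (⟨x (Sum.inr 0), hy0⟩ : K₀))
  have hy1 : x (Sum.inr 1) ∈ K₀ := by rw [hrel2]; exact K₀.sub_mem K₀.one_mem hy0
  have h11 : IsIntegral K₀ (x (Sum.inr 1)) :=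
    isIntegral_algebraMap (A := Q) (x := (⟨x (Sum.inr 1), hy1⟩ : K₀))
  -- `x̄₁` is a root of the monic `Tᴺ - (1 - x̄₀ᴺ) ∈ K₀[T]`
  have hcK : 1 - x (Sum.inl 0) ^ N ∈ K₀ := K₀.sub_mem K₀.one_mem (K₀.pow_mem hx0 N)
  have h01 : IsIntegral K₀ (x (Sum.inl 1)) := by
    refine ⟨Polynomial.X ^ N - Polynomial.C ⟨1 - x (Sum.inl 0) ^ N, hcK⟩,
      Polynomial.monic_X_pow_sub_C _ (by omega), ?_⟩
    rw [Polynomial.eval₂_sub, Polynomial.eval₂_X_pow, Polynomial.eval₂_C]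
    change x (Sum.inl 1) ^ N - (1 - x (Sum.inl 0) ^ N) = 0
    rw [hrel1, sub_self]
  have hgen : ∀ v, IsIntegral K₀ (x v) := by
    rintro (j | j) <;> fin_cases j
    exacts [h00, h01, h10, h11]
  -- hence `Q` is integral (so algebraic) over `K₀`
  have htop : Algebra.adjoin ℂ (Set.range x) = ⊤ := by
    have h1 : Algebra.adjoin ℂ (Set.range x) =
        (Algebra.adjoin ℂ (Set.range (X : Fin 2 ⊕ Fin 2 → MvPolynomial (Fin 2 ⊕ Fin 2) ℂ))).map
          (Ideal.Quotient.mkₐ ℂ I) := by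
      rw [AlgHom.map_adjoin, ← Set.range_comp]; rfl
    rw [h1, MvPolynomial.adjoin_range_X, Algebra.map_top, AlgHom.range_eq_top]
    exact Ideal.Quotient.mkₐ_surjective ℂ I
  haveI hint : Algebra.IsIntegral K₀ Q := by
    refine ⟨fun q => ?_⟩
    have hq : q ∈ Algebra.adjoin ℂ (Set.range x) := by rw [htop]; exact Algebra.mem_top
    have hle : Algebra.adjoin ℂ (Set.range x) ≤ (integralClosure K₀ Q).restrictScalars ℂ := by
      refine Algebra.adjoin_le ?_
      rintro _ ⟨v, rfl⟩
      exact hgen v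
    exact hle hq
  haveI : Algebra.IsAlgebraic K₀ Q := ⟨fun q => (hint.isIntegral q).isAlgebraic⟩
  have htr : Algebra.trdeg ℂ Q ≤ Cardinal.mk s₀ := Algebra.IsAlgebraic.trdeg_le_cardinalMk ℂ s₀
  have hcard : Cardinal.mk s₀ ≤ 2 := by
    rw [hs₀]
    calc Cardinal.mk ({x (Sum.inl 0), x (Sum.inr 0)} : Set Q)
        ≤ Cardinal.mk ({x (Sum.inr 0)} : Set Q) + 1 := Cardinal.mk_insert_le
      _ = 2 := by rw [Cardinal.mk_singleton]; norm_num
  have h2 : Cardinal.toNat (Algebra.trdeg ℂ Q) ≤ 2 := by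
    have := Cardinal.toNat_le_toNat (htr.trans hcard) (by exact Cardinal.natCast_lt_aleph0)
    simpa using this
  exact_mod_cast h2

end Surface

end Summit.Schanuel.Schanuel.Theorems
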